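import Summits.QuantumFields.YangMills.Theorems.BalabanUVNodesN13WindowAtRecord13SepCoPH

/-!
# Crux K1⁷ — THE EXACT CRITERION FOR THE `K ≥ 1` SMALL-COUPLING WINDOW (flow side for every generated flow; at NODE 00's Stage-13 datum
# `Node00.datumOfRecord₁₃SepCoPH F N θ h`): the `∃ γ₁` is spurious; the window holds IFF `g ↦ g⁻² − β 0 (g)` is NOT eventually bounded above at `0⁺`;
# the disprover's exact target; the weakest located sufficient input (a FREQUENT upper bound on the first β-function)

Cell `pub-ymgap`, YM-PLAN Track A (HUMAN RULING D-0062 ∕ D-0149, director-ym №197), WIDTH SEAT `pub-ymgap-dag-n13-w4` (g2) on NODE n13 [Balaban1989LargeFieldII]; helper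
(`--supports`) for crux K1⁷ `StabilityBAtRecordR13SepCoPH` = stmt-QuantumFields-20542 (plan g73 rev 24∕25; skeleton v5 `K1Skeleton13SepCoPHv5.lean` 38c62055d1ac34a4), whose LAST
CONJUNCT — and the window hypothesis of K2⁷ `EndpointGivenBR13SepCoPH` — is the `K ≥ 1` WINDOW `∃ γ₁ > 0, ∀ γ ∈ ]0, γ₁], ∃ P, 1 ≤ P.K ∧ (D.C P).flow.InInterval γ P.K`.
SUCCESSOR STOREY of W-SEAT-START-LIST §1 n13 ITEM 4 = n24 ITEM 2 (one declarer: this seat; files of record `…K1WindowFirstStep` ∕ `…N13WindowAtRecord13SepCoPH`, g0).  COUNT-NEUTRAL.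

WHY THIS FILE.  The window of a GENERATED flow is a condition on ONE real function, the first β-function `g ↦ β 0 (g)` near `0⁺` (node00-def-K0a ROW W12
`Node00.window_genSeq_iff`; at the record g0's `window_datumOfRecord₁₃SepCoPH_iff_merged`: the MERGED first β-function `β_m 0` of the record's `(TcanOfRecord, χ^{(2.9)})` term
family).  The located forms so far are one-sided: SUFFICIENT «`β 0` bounded above ∕ `g²β 0 (g) ≤ c < 1` eventually or frequently ∕ the one-sided limit exists» and NECESSARY
«`g²β 0 (g) < 1` frequently».  THIS FILE CLOSES THE GAP with the exact criterion, in Mathlib's filter vocabulary: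

  `Window ⟺ ∀ M, ∃ᶠ g in 𝓝[>] 0, M ≤ g⁻² − β 0 (g) ⟺ ¬ Filter.IsBoundedUnder (· ≤ ·) (𝓝[>] 0) (g ↦ g⁻² − β 0 (g))`,

i.e. THE WINDOW FAILS IFF `∃ M, ∀ᶠ g in 𝓝[>] 0, g⁻² − M ≤ β 0 (g)` — the first β-function DOMINATES `g⁻² − M` near `0⁺`.  Print's first β-function tends to the one-loop number
`β⁰_1` ([Balaban1987RG1] (2.12)–(2.14) p. 268, «vanishes at `g_k = 0`»; p. 264 «uniformly bounded»), so print is as far from the failure region as possible; but NO lemma of the tree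
bounds `β_m 0` (NODE O's first-step estimate; g0's census), and this file does not either.  Two more bookkeeping facts: the `∃ γ₁` of the conjunct is SPURIOUS for EVERY construction
(`InInterval` is monotone in `γ`: a window at some scale is a window at every scale), and the WEAKEST located sufficient input is a FREQUENT upper bound «`∃ b, ∃ᶠ g in 𝓝[>] 0,
β 0 (g) ≤ b`» (along SOME sequence of bare couplings `gₙ → 0⁺` the first β-function stays below SOME constant) — weaker than every sufficient form of record.

WHAT THIS FILE PROVES (theorems only, 0 `def`, 0 `sorry`; general `N` at the record, `N = 2` faces in §4).
* §0 generic filter∕order lemmas on a real function `u` along a filter `l`: `forall_frequently_le_iff_not_isBoundedUnder` · `isBoundedUnder_sub_iff_exists_eventually_le` ·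
  `eventually_le_one_div_sq_nhdsGT` (`M ≤ g⁻²` eventually at `0⁺`).
* §1 quantifier bookkeeping (every construction ∕ every family of coupling sequences): `window_iff_forall_pos_seq` · `window_iff_forall_pos` — `(∃ γ₁ > 0, ∀ γ ∈ ]0, γ₁], …) ↔ (∀ γ > 0, …)`.
* §2 flow side, every `β : HBeta`: ★ `firstStep_all_of_frequently_le` · ★★ `firstStep_iff_frequently_le` · `firstStep_iff_not_isBoundedUnder` · `not_firstStep_iff_eventually_le` ·
  `firstStep_of_frequently_beta_le`; for GENERATED flows (`FlowStepRuns.genSeq`): ★★ `window_genSeq_iff_frequently_le` · ★ `window_genSeq_iff_not_isBoundedUnder` ·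
  ★ `not_window_genSeq_iff_eventually_le` (THE EXACT FAILURE MODE) · `window_genSeq_of_frequently_beta_le`; for every FORWARD-GENERATED construction and every finite-ε datum
  (sufficiency only: `DagBinding.ForwardGenerated` pins `g_1` only while the right side of (0.20) is positive): `window_of_forwardGenerated_of_frequently_le` · `window_of_frequently_le` ·
  `window_of_frequently_beta_le`.
* §3 AT THE STAGE-13 DATUM `datumOfRecord₁₃SepCoPH F N θ h` (every proviso witness `h`): `window_datumOfRecord₁₃SepCoPH_iff_forall_pos` (no hypothesis) ·
  `window_datumOfRecord₁₃SepCoPH_iff_frequently_le_firstBeta` (raw β of record; no hypothesis) · ★★ `window_datumOfRecord₁₃SepCoPH_iff_frequently_le_merged` (`0 < θ.γ`) ·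
  ★★ `window_datumOfRecord₁₃SepCoPH_iff_not_isBoundedUnder_merged` · ★★ `not_window_datumOfRecord₁₃SepCoPH_iff_eventually_le_merged` (THE DISPROVER's EXACT TARGET at the record:
  `∃ M, ∀ᶠ g in 𝓝[>] 0, g⁻² − M ≤ β_m 0 (g)`) · ★ `window_datumOfRecord₁₃SepCoPH_of_frequently_betaMerged_le` (weakest located sufficient input).
* §4 the item's `N = 2` text, keyed on the item's own `θ.Admissible F 2` (`0 < θ.γ` = `Stage9Params.Admissible.gamma_pos`): `window₂_datumOfRecord₁₃SepCoPH_iff_not_isBoundedUnder_merged` ·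
  `not_window₂_datumOfRecord₁₃SepCoPH_iff_eventually_le_merged`.

HONEST SCOPE (A6, №189).  Elementary filter∕order bookkeeping on ONE real function plus ROW W12's and g0's kernel identities; every theorem at the record quantifies over
`(θ, h : θ.Provisos₁₃SepCoPH F N)` — inhabited iff K0⁷ `Record13SepCoPHInhabited` (open crux stmt-QuantumFields-20541); the `iff`s are hypothesis-free beyond `0 < θ.γ` (an
admissibility numeral), the sufficient forms DISPLAY their β-input and discharge nothing.  Nothing of Bałaban's analysis is asserted or used; N13 NOT discharged; K1⁷ ∕ K2⁷ NOT
closed; no stub closed; counts unmoved (typed 28∕28 · discharged 5∕27 · A 5∕28).  One finite four-torus programme at fixed `ε = L^{−K}`, Bałaban AS PRINTED; the YM mass gap (Clay)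
is NOT proved by any of this — R4 closes the conditional finite-𝕋⁴ rung `BalabanLadder.UV` only; nothing continuum ∕ ℝ⁴ ∕ OS.  No `def`, no `instance`, no `notation`, no `axiom`.
References: [I] = [Balaban1987RG1] CMP **109** (1987): (0.17)–(0.20) pp. 255–256, (1.20)–(1.22) p. 264, (2.9) p. 266, (2.12)–(2.14) p. 268; [B16] = [Balaban1989LargeFieldII]
CMP **122** (1989): Thm 1 + (0.1) pp. 355–356.
-/

noncomputable section

open scoped Matrix.Norms.L2Operator

namespace Summit.QuantumFields.YangMills.Theorems.BalabanUVNodesK1WindowExactCriterion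

open Literature.MathematicalPhysics.QuantumFieldTheory.Balaban1983to89
open Literature.MathematicalPhysics.QuantumFieldTheory.Balaban1983to89.FlowStep
open Literature.MathematicalPhysics.QuantumFieldTheory.Balaban1983to89.FlowStepRuns
open Literature.MathematicalPhysics.QuantumFieldTheory.Balaban1983to89.DagBinding
open Literature.MathematicalPhysics.QuantumFieldTheory.Balaban1983to89.T4Continuum (T4Family FiniteEpsData)
open Literature.MathematicalPhysics.QuantumFieldTheory.Balaban1983to89.Node00
open Summit.QuantumFields.YangMills.Theorems.BalabanUVNodesK1WindowFirstStep
open Summit.QuantumFields.YangMills.Theorems.BalabanUVNodesN13WindowAtRecord13SepCoPH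
open Filter Topology

/-! ## §0. Generic filter ∕ order lemmas on one real function -/

section Generic

variable {α : Type*}

/-- **«Above every level frequently» is «not eventually bounded above».**  For a real function `u` along a filter `l`:
`(∀ M, ∃ᶠ x in l, M ≤ u x) ↔ ¬ Filter.IsBoundedUnder (· ≤ ·) l u` (`IsBoundedUnder (· ≤ ·) l u` = `∃ b, ∀ᶠ x in l, u x ≤ b`). [folklore] -/
theorem forall_frequently_le_iff_not_isBoundedUnder (l : Filter α) (u : α → ℝ) :
    (∀ M : ℝ, ∃ᶠ x in l, M ≤ u x) ↔ ¬ IsBoundedUnder (· ≤ ·) l u := by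
  constructor
  · rintro h ⟨b, hb⟩
    have hb' : ∀ᶠ x in l, u x ≤ b := Filter.eventually_map.mp hb
    obtain ⟨x, hx, hxb⟩ := ((h (b + 1)).and_eventually hb').exists
    linarith
  · intro h M
    by_contra hM
    rw [Filter.not_frequently] at hM
    exact h ⟨M, Filter.eventually_map.mpr (hM.mono fun x hx => (not_le.mp hx).le)⟩

/-- **A difference `v − u` is eventually bounded above iff `u` eventually dominates `v − M` for some `M`.** [folklore] -/
theorem isBoundedUnder_sub_iff_exists_eventually_le (l : Filter α) (u v : α → ℝ) :
    IsBoundedUnder (· ≤ ·) l (fun x => v x - u x) ↔ ∃ M : ℝ, ∀ᶠ x in l, v x - M ≤ u x := by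
  constructor
  · rintro ⟨b, hb⟩
    exact ⟨b, (Filter.eventually_map.mp hb).mono fun x hx => by linarith⟩
  · rintro ⟨M, hM⟩
    exact ⟨M, Filter.eventually_map.mpr (hM.mono fun x hx => by linarith)⟩

/-- **`g⁻²` exceeds every level eventually at `0⁺`**: `∀ M, ∀ᶠ g in 𝓝[>] 0, M ≤ 1∕g²` (for `0 < g < δ := 1∕max M 1 ≤ 1`: `g² < δ² ≤ δ`, so `g⁻² > max M 1 ≥ M`). [folklore] -/
theorem eventually_le_one_div_sq_nhdsGT (M : ℝ) : ∀ᶠ g in 𝓝[>] (0 : ℝ), M ≤ 1 / g ^ 2 := by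
  set M' : ℝ := max M 1 with hM'
  have hM'1 : 1 ≤ M' := le_max_right _ _
  have hM'0 : 0 < M' := lt_of_lt_of_le one_pos hM'1
  have hδ : 0 < 1 / M' := by positivity
  have hδ1 : 1 / M' ≤ 1 := (div_le_one hM'0).mpr hM'1
  have hlt : ∀ᶠ g in 𝓝[>] (0 : ℝ), g < 1 / M' := (eventually_lt_nhds hδ).filter_mono nhdsWithin_le_nhds
  have hpos : ∀ᶠ g in 𝓝[>] (0 : ℝ), 0 < g := eventually_mem_nhdsWithin
  filter_upwards [hlt, hpos] with g hg hg0
  have hg2 : 0 < g ^ 2 := pow_pos hg0 2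
  have hsq : g ^ 2 < 1 / M' := by nlinarith
  have hM'lt : M' < 1 / g ^ 2 := by
    have h := one_div_lt_one_div_of_lt hg2 hsq
    rwa [one_div_one_div] at h
  exact (le_max_left M 1).trans hM'lt.le

end Generic

/-! ## §1. Quantifier bookkeeping: the `∃ γ₁` of the window is spurious (a window at some scale is a window at every scale) -/

section Quantifier

/-- **THE `∃ γ₁` IS SPURIOUS (sequence form).**  For ANY family `s P` of coupling sequences: `(∃ γ₁ > 0, ∀ γ ∈ ]0, γ₁], ∃ P, 1 ≤ P.K ∧ s P ∈ ]0, γ]` up to `P.K`) ↔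
`(∀ γ > 0, ∃ P, 1 ≤ P.K ∧ s P ∈ ]0, γ]` up to `P.K`)` — for `γ > γ₁` the witness at `γ₁` serves (`]0, γ₁] ⊆ ]0, γ]`). [cite: Balaban1987RG1, Thm 1 p.259 (the interval `]0, γ]`; elementary)] -/
theorem window_iff_forall_pos_seq (s : B12.RunParams → ℕ → ℝ) :
    (∃ γ₁ : ℝ, 0 < γ₁ ∧ ∀ γ : ℝ, 0 < γ → γ ≤ γ₁ → ∃ P : B12.RunParams, 1 ≤ P.K ∧ Step.InInterval γ P.K (s P)) ↔
      ∀ γ : ℝ, 0 < γ → ∃ P : B12.RunParams, 1 ≤ P.K ∧ Step.InInterval γ P.K (s P) := by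
  constructor
  · rintro ⟨γ₁, hγ₁, h⟩ γ hγ
    rcases le_or_gt γ γ₁ with hle | hlt
    · exact h γ hγ hle
    · obtain ⟨P, hK, hI⟩ := h γ₁ hγ₁ le_rfl
      exact ⟨P, hK, fun k hk => ⟨(hI k hk).1, (hI k hk).2.trans hlt.le⟩⟩
  · exact fun h => ⟨1, one_pos, fun γ hγ _ => h γ hγ⟩

/-- **THE `∃ γ₁` IS SPURIOUS (construction form).**  For ANY construction `C : B12.Construction`: the `K ≥ 1` window `∃ γ₁ > 0, ∀ γ ∈ ]0, γ₁], ∃ P, 1 ≤ P.K ∧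
(C P).flow.InInterval γ P.K` holds iff `∀ γ > 0, ∃ P, 1 ≤ P.K ∧ (C P).flow.InInterval γ P.K`. [cite: Balaban1987RG1, Thm 1 p.259 (the interval `]0, γ]`; elementary)] -/
theorem window_iff_forall_pos (C : B12.Construction) :
    (∃ γ₁ : ℝ, 0 < γ₁ ∧ ∀ γ : ℝ, 0 < γ → γ ≤ γ₁ → ∃ P : B12.RunParams, 1 ≤ P.K ∧ (C P).flow.InInterval γ P.K) ↔
      ∀ γ : ℝ, 0 < γ → ∃ P : B12.RunParams, 1 ≤ P.K ∧ (C P).flow.InInterval γ P.K :=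
  window_iff_forall_pos_seq fun P => (C P).flow.g

end Quantifier

/-! ## §2. Flow side: the exact criterion on the first β-function of a history family `β : HBeta` -/

section Flow

/-- ★ **ABOVE EVERY LEVEL FREQUENTLY ⟹ THE FIRST-STEP CONDITION AT EVERY SCALE.**  If `g⁻² − β 0 (g)` exceeds every `M` frequently as `g → 0⁺`, then for EVERY `γ > 0` some
`g₀ ∈ ]0, γ]` has `β 0 (g₀) ≤ 1∕g₀² − 1∕γ²` (take `M := γ⁻²` and a good `g₀ < γ`). [cite: Balaban1987RG1, (0.18)–(0.20) pp.255–256 and §1 p.264 (elementary)] -/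
theorem firstStep_all_of_frequently_le (β : HBeta) (h : ∀ M : ℝ, ∃ᶠ x in 𝓝[>] (0 : ℝ), M ≤ 1 / x ^ 2 - β 0 (fun _ => x)) :
    ∀ γ : ℝ, 0 < γ → ∃ g0 : ℝ, (0 < g0 ∧ g0 ≤ γ) ∧ β 0 (fun _ => g0) ≤ 1 / g0 ^ 2 - 1 / γ ^ 2 := by
  intro γ hγ
  have hlt : ∀ᶠ x in 𝓝[>] (0 : ℝ), x < γ := (eventually_lt_nhds hγ).filter_mono nhdsWithin_le_nhds
  have hpos : ∀ᶠ x in 𝓝[>] (0 : ℝ), 0 < x := eventually_mem_nhdsWithin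
  obtain ⟨g0, hM, hg0lt, hg0⟩ := ((h (1 / γ ^ 2)).and_eventually (hlt.and hpos)).exists
  exact ⟨g0, ⟨hg0, hg0lt.le⟩, by linarith⟩

/-- ★★ **THE EXACT CRITERION (flow side).**  ROW W12's first-step condition «∃ γ₁ > 0, ∀ γ ∈ ]0, γ₁], ∃ g₀ ∈ ]0, γ], `β 0 (g₀) ≤ 1∕g₀² − 1∕γ²`» holds IFF
`∀ M, ∃ᶠ g in 𝓝[>] 0, M ≤ 1∕g² − β 0 (g)` — «`g⁻² − β 0 (g)` is unbounded above along every approach to `0⁺`».  (⟹: for `M` and a neighbourhood `]0, u[` take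
`γ := min γ₁ (min (u∕2) (1∕max M 1))`, so `γ⁻² ≥ max M 1 ≥ M`, and the window's `g₀ ∈ ]0, γ] ⊆ ]0, u[`; ⟸: `firstStep_all_of_frequently_le`.)
[cite: Balaban1987RG1, (0.18)–(0.20) pp.255–256 and §1 p.264 (elementary)] -/
theorem firstStep_iff_frequently_le (β : HBeta) :
    (∃ γ₁ : ℝ, 0 < γ₁ ∧ ∀ γ : ℝ, 0 < γ → γ ≤ γ₁ →
        ∃ g0 : ℝ, (0 < g0 ∧ g0 ≤ γ) ∧ β 0 (fun _ => g0) ≤ 1 / g0 ^ 2 - 1 / γ ^ 2) ↔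
      ∀ M : ℝ, ∃ᶠ x in 𝓝[>] (0 : ℝ), M ≤ 1 / x ^ 2 - β 0 (fun _ => x) := by
  constructor
  · rintro ⟨γ₁, hγ₁, h⟩ M
    rw [Filter.frequently_iff]
    intro U hU
    obtain ⟨u, hu, hsub⟩ := mem_nhdsGT_iff_exists_Ioo_subset.mp hU
    have hu0 : (0 : ℝ) < u := hu
    set M' : ℝ := max M 1 with hM'
    have hM'1 : 1 ≤ M' := le_max_right _ _
    have hM'0 : 0 < M' := lt_of_lt_of_le one_pos hM'1
    set γ : ℝ := min γ₁ (min (u / 2) (1 / M')) with hγdef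
    have hγ0 : 0 < γ := lt_min hγ₁ (lt_min (by positivity) (by positivity))
    have hγ1 : γ ≤ γ₁ := min_le_left _ _
    have hγu : γ ≤ u / 2 := (min_le_right _ _).trans (min_le_left _ _)
    have hγM : γ ≤ 1 / M' := (min_le_right _ _).trans (min_le_right _ _)
    have hγle1 : γ ≤ 1 := hγM.trans ((div_le_one hM'0).mpr hM'1)
    obtain ⟨g0, ⟨hg0, hg0γ⟩, hβ⟩ := h γ hγ0 hγ1
    refine ⟨g0, hsub ⟨hg0, by linarith⟩, ?_⟩
    -- `γ² ≤ γ ≤ 1∕M'`, hence `M ≤ M' ≤ 1∕γ²`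
    have hγsq : γ ^ 2 ≤ 1 / M' := by nlinarith
    have hMγ : M' ≤ 1 / γ ^ 2 := by
      have h1 := one_div_le_one_div_of_le (pow_pos hγ0 2) hγsq
      rwa [one_div_one_div] at h1
    linarith [le_max_left M 1]
  · intro h
    exact ⟨1, one_pos, fun γ hγ _ => firstStep_all_of_frequently_le β h γ hγ⟩

/-- **THE EXACT CRITERION, `IsBoundedUnder` form**: the first-step condition ↔ `¬ IsBoundedUnder (· ≤ ·) (𝓝[>] 0) (g ↦ 1∕g² − β 0 (g))`.
[cite: Balaban1987RG1, (0.18)–(0.20) pp.255–256 and §1 p.264 (elementary)] -/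
theorem firstStep_iff_not_isBoundedUnder (β : HBeta) :
    (∃ γ₁ : ℝ, 0 < γ₁ ∧ ∀ γ : ℝ, 0 < γ → γ ≤ γ₁ →
        ∃ g0 : ℝ, (0 < g0 ∧ g0 ≤ γ) ∧ β 0 (fun _ => g0) ≤ 1 / g0 ^ 2 - 1 / γ ^ 2) ↔
      ¬ IsBoundedUnder (· ≤ ·) (𝓝[>] (0 : ℝ)) (fun x : ℝ => 1 / x ^ 2 - β 0 (fun _ => x)) :=
  (firstStep_iff_frequently_le β).trans (forall_frequently_le_iff_not_isBoundedUnder _ _)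

/-- **THE EXACT FAILURE MODE (flow side)**: the first-step condition FAILS iff `∃ M, ∀ᶠ g in 𝓝[>] 0, 1∕g² − M ≤ β 0 (g)` — the first β-function dominates `g⁻² − M` near `0⁺`.
[cite: Balaban1987RG1, (0.18)–(0.20) pp.255–256 and §1 p.264 (elementary)] -/
theorem not_firstStep_iff_eventually_le (β : HBeta) :
    (¬ ∃ γ₁ : ℝ, 0 < γ₁ ∧ ∀ γ : ℝ, 0 < γ → γ ≤ γ₁ →
        ∃ g0 : ℝ, (0 < g0 ∧ g0 ≤ γ) ∧ β 0 (fun _ => g0) ≤ 1 / g0 ^ 2 - 1 / γ ^ 2) ↔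
      ∃ M : ℝ, ∀ᶠ x in 𝓝[>] (0 : ℝ), 1 / x ^ 2 - M ≤ β 0 (fun _ => x) := by
  rw [firstStep_iff_not_isBoundedUnder, not_not]
  exact isBoundedUnder_sub_iff_exists_eventually_le _ _ _

/-- **THE WEAKEST LOCATED SUFFICIENT INPUT: a FREQUENT upper bound** — `∃ b, ∃ᶠ g in 𝓝[>] 0, β 0 (g) ≤ b` (along SOME sequence of bare couplings `gₙ → 0⁺` the first β-function stays
below SOME constant) ⟹ the first-step condition (there `g⁻² − β 0 (g) ≥ g⁻² − b → ∞`).  Weaker than each sufficient form of record (level-0 bound, eventual bound, one-sided limit,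
`g²β ≤ c < 1` eventually ∕ frequently). [cite: Balaban1987RG1, (0.18)–(0.20) pp.255–256 and §1 p.264 (elementary)] -/
theorem firstStep_of_frequently_beta_le (β : HBeta) (h : ∃ b : ℝ, ∃ᶠ x in 𝓝[>] (0 : ℝ), β 0 (fun _ => x) ≤ b) :
    ∃ γ₁ : ℝ, 0 < γ₁ ∧ ∀ γ : ℝ, 0 < γ → γ ≤ γ₁ →
      ∃ g0 : ℝ, (0 < g0 ∧ g0 ≤ γ) ∧ β 0 (fun _ => g0) ≤ 1 / g0 ^ 2 - 1 / γ ^ 2 := by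
  obtain ⟨b, hb⟩ := h
  refine (firstStep_iff_frequently_le β).mpr fun M => ?_
  exact (hb.and_eventually (eventually_le_one_div_sq_nhdsGT (M + b))).mono fun x ⟨hx, hM⟩ => by linarith

/-- ★★ **THE EXACT CRITERION FOR A GENERATED FLOW.**  For `genSeq β g₀` ((0.18)∕(0.20) solved forward from the bare coupling): the `K ≥ 1` window
`∃ γ₁ > 0, ∀ γ ∈ ]0, γ₁], ∃ P, 1 ≤ P.K ∧ g_k(P) ∈ ]0, γ] ∀ k ≤ P.K` holds IFF `∀ M, ∃ᶠ g in 𝓝[>] 0, M ≤ 1∕g² − β 0 (g)` (ROW W12's `Node00.window_genSeq_iff` + §2's criterion).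
[cite: Balaban1987RG1, (0.17)–(0.20) pp.255–256 and §1 p.264 (elementary)] -/
theorem window_genSeq_iff_frequently_le (β : HBeta) :
    (∃ γ₁ : ℝ, 0 < γ₁ ∧ ∀ γ : ℝ, 0 < γ → γ ≤ γ₁ → ∃ P : B12.RunParams, 1 ≤ P.K ∧ Step.InInterval γ P.K (genSeq β P.g0)) ↔
      ∀ M : ℝ, ∃ᶠ x in 𝓝[>] (0 : ℝ), M ≤ 1 / x ^ 2 - β 0 (fun _ => x) :=
  (window_genSeq_iff β).trans (firstStep_iff_frequently_le β)

/-- ★ **THE EXACT CRITERION FOR A GENERATED FLOW, `IsBoundedUnder` form**: the window ↔ `¬ IsBoundedUnder (· ≤ ·) (𝓝[>] 0) (g ↦ 1∕g² − β 0 (g))`.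
[cite: Balaban1987RG1, (0.17)–(0.20) pp.255–256 and §1 p.264 (elementary)] -/
theorem window_genSeq_iff_not_isBoundedUnder (β : HBeta) :
    (∃ γ₁ : ℝ, 0 < γ₁ ∧ ∀ γ : ℝ, 0 < γ → γ ≤ γ₁ → ∃ P : B12.RunParams, 1 ≤ P.K ∧ Step.InInterval γ P.K (genSeq β P.g0)) ↔
      ¬ IsBoundedUnder (· ≤ ·) (𝓝[>] (0 : ℝ)) (fun x : ℝ => 1 / x ^ 2 - β 0 (fun _ => x)) :=
  (window_genSeq_iff β).trans (firstStep_iff_not_isBoundedUnder β)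

/-- ★ **THE EXACT FAILURE MODE OF THE WINDOW OF A GENERATED FLOW**: it FAILS iff `∃ M, ∀ᶠ g in 𝓝[>] 0, 1∕g² − M ≤ β 0 (g)` — the ONLY obstruction is a first β-function
dominating `g⁻² − M` near `0⁺` (compare ROW W12's necessary `sq_mul_betaMerged_lt_one_of_window` and g0's sufficient `firstStep_of_sq_mul_le`, both corollaries).
[cite: Balaban1987RG1, (0.17)–(0.20) pp.255–256 and §1 p.264 (elementary)] -/
theorem not_window_genSeq_iff_eventually_le (β : HBeta) :
    (¬ ∃ γ₁ : ℝ, 0 < γ₁ ∧ ∀ γ : ℝ, 0 < γ → γ ≤ γ₁ → ∃ P : B12.RunParams, 1 ≤ P.K ∧ Step.InInterval γ P.K (genSeq β P.g0)) ↔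
      ∃ M : ℝ, ∀ᶠ x in 𝓝[>] (0 : ℝ), 1 / x ^ 2 - M ≤ β 0 (fun _ => x) := by
  rw [window_genSeq_iff β]
  exact not_firstStep_iff_eventually_le β

/-- **A FREQUENT upper bound on the first β-function gives the window of a generated flow.** [cite: Balaban1987RG1, (0.17)–(0.20) pp.255–256 and §1 p.264 (elementary)] -/
theorem window_genSeq_of_frequently_beta_le (β : HBeta) (h : ∃ b : ℝ, ∃ᶠ x in 𝓝[>] (0 : ℝ), β 0 (fun _ => x) ≤ b) :
    ∃ γ₁ : ℝ, 0 < γ₁ ∧ ∀ γ : ℝ, 0 < γ → γ ≤ γ₁ → ∃ P : B12.RunParams, 1 ≤ P.K ∧ Step.InInterval γ P.K (genSeq β P.g0) :=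
  (window_genSeq_iff β).mpr (firstStep_of_frequently_beta_le β h)

/-- **SUFFICIENCY FOR EVERY FORWARD-GENERATED CONSTRUCTION** (`DagBinding.ForwardGenerated C β`; g0's `window_of_forwardGenerated_of_firstStep`): `∀ M, ∃ᶠ g in 𝓝[>] 0,
M ≤ 1∕g² − β 0 (g)` ⟹ the `K ≥ 1` window of `C`.  (Only sufficiency: forward generation pins `g_1` while the right side of (0.20) is positive, so an arbitrary construction may
have windows its `β` does not see.) [cite: Balaban1987RG1, (0.17)–(0.20) pp.255–256 (elementary)] -/
theorem window_of_forwardGenerated_of_frequently_le (C : B12.Construction) (β : HBeta) (hgen : ForwardGenerated C β)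
    (h : ∀ M : ℝ, ∃ᶠ x in 𝓝[>] (0 : ℝ), M ≤ 1 / x ^ 2 - β 0 (fun _ => x)) :
    ∃ γ₁ : ℝ, 0 < γ₁ ∧ ∀ γ : ℝ, 0 < γ → γ ≤ γ₁ → ∃ P : B12.RunParams, 1 ≤ P.K ∧ (C P).flow.InInterval γ P.K :=
  window_of_forwardGenerated_of_firstStep C β hgen ((firstStep_iff_frequently_le β).mpr h)

variable {F : T4Family} {G : Type*} [GaugeGroup G] [MeasurableSpace G] [HaarData G] in
/-- **SUFFICIENCY AT EVERY FINITE-ε DATUM** (`D.fwd`): `∀ M, ∃ᶠ g in 𝓝[>] 0, M ≤ 1∕g² − D.βfun 0 (g)` ⟹ the `K ≥ 1` window of `D`. [cite: Balaban1987RG1, (0.17)–(0.20) pp.255–256 (elementary)] -/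
theorem window_of_frequently_le (D : FiniteEpsData F G) (h : ∀ M : ℝ, ∃ᶠ x in 𝓝[>] (0 : ℝ), M ≤ 1 / x ^ 2 - D.βfun 0 (fun _ => x)) :
    ∃ γ₁ : ℝ, 0 < γ₁ ∧ ∀ γ : ℝ, 0 < γ → γ ≤ γ₁ → ∃ P : B12.RunParams, 1 ≤ P.K ∧ (D.C P).flow.InInterval γ P.K :=
  window_of_forwardGenerated_of_frequently_le D.C.toB12 D.βfun D.fwd h

variable {F : T4Family} {G : Type*} [GaugeGroup G] [MeasurableSpace G] [HaarData G] in
/-- **SUFFICIENCY AT EVERY FINITE-ε DATUM from a FREQUENT upper bound** `∃ b, ∃ᶠ g in 𝓝[>] 0, D.βfun 0 (g) ≤ b`. [cite: Balaban1987RG1, (0.17)–(0.20) pp.255–256 and §1 p.264 (elementary)] -/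
theorem window_of_frequently_beta_le (D : FiniteEpsData F G) (h : ∃ b : ℝ, ∃ᶠ x in 𝓝[>] (0 : ℝ), D.βfun 0 (fun _ => x) ≤ b) :
    ∃ γ₁ : ℝ, 0 < γ₁ ∧ ∀ γ : ℝ, 0 < γ → γ ≤ γ₁ → ∃ P : B12.RunParams, 1 ≤ P.K ∧ (D.C P).flow.InInterval γ P.K :=
  window_of_firstStep D (firstStep_of_frequently_beta_le D.βfun h)

end Flow

/-! ## §3. At NODE 00's Stage-13 datum `datumOfRecord₁₃SepCoPH F N θ h`: the exact criterion reads the MERGED first β-function of record -/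

section Record

variable {F : T4Family} {N : ℕ} [NeZero N]

/-- **THE `∃ γ₁` OF K1⁷'s LAST CONJUNCT IS SPURIOUS** (every `θ`, every proviso witness `h`; no hypothesis): the window at the Stage-13 datum ↔
`∀ γ > 0, ∃ P, 1 ≤ P.K ∧ ((datumOfRecord₁₃SepCoPH F N θ h).C P).flow.InInterval γ P.K`. [cite: Balaban1987RG1, Thm 1 p.259; Balaban1989LargeFieldII, Thm 1 p.355 (the interval `]0, γ]`; elementary)] -/
theorem window_datumOfRecord₁₃SepCoPH_iff_forall_pos (θ : Stage13HParams F N) (h : θ.Provisos₁₃SepCoPH F N) :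
    (∃ γ₁ : ℝ, 0 < γ₁ ∧ ∀ γ : ℝ, 0 < γ → γ ≤ γ₁ →
        ∃ P : B12.RunParams, 1 ≤ P.K ∧ ((datumOfRecord₁₃SepCoPH F N θ h).C P).flow.InInterval γ P.K) ↔
      ∀ γ : ℝ, 0 < γ → ∃ P : B12.RunParams, 1 ≤ P.K ∧ ((datumOfRecord₁₃SepCoPH F N θ h).C P).flow.InInterval γ P.K :=
  window_iff_forall_pos (datumOfRecord₁₃SepCoPH F N θ h).C.toB12

/-- **THE EXACT CRITERION AT THE RECORD, raw β of record** (every `h`; no hypothesis): the window ↔ `∀ M, ∃ᶠ g in 𝓝[>] 0, M ≤ 1∕g² − betaOfRecord₁₃ F N θ.toStage13Params 0 (g)`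
(g0's `window_datumOfRecord₁₃SepCoPH_iff_firstBeta` + §2). [cite: Balaban1987RG1, (0.17)–(0.20) pp.255–256 and (1.20)–(1.22) p.264; Balaban1989LargeFieldII, Thm 1 + (0.1) pp.355–356 (bookkeeping + elementary)] -/
theorem window_datumOfRecord₁₃SepCoPH_iff_frequently_le_firstBeta (θ : Stage13HParams F N) (h : θ.Provisos₁₃SepCoPH F N) :
    (∃ γ₁ : ℝ, 0 < γ₁ ∧ ∀ γ : ℝ, 0 < γ → γ ≤ γ₁ →
        ∃ P : B12.RunParams, 1 ≤ P.K ∧ ((datumOfRecord₁₃SepCoPH F N θ h).C P).flow.InInterval γ P.K) ↔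
      ∀ M : ℝ, ∃ᶠ x in 𝓝[>] (0 : ℝ), M ≤ 1 / x ^ 2 - betaOfRecord₁₃ F N θ.toStage13Params 0 (fun _ => x) :=
  (window_datumOfRecord₁₃SepCoPH_iff_firstBeta θ h).trans (firstStep_iff_frequently_le _)

/-- Near `0⁺` the first β-function of record IS the merged one (`0 < θ.γ`): `∀ᶠ g in 𝓝[>] 0, betaOfRecord₁₃ … 0 (g) = β_m 0 (g)` (g0's face `betaOfRecord₁₃_zero_const_of_le` on `]0, θ.γ]`).
[cite: Balaban1987RG1, (1.20)–(1.22) p.264 and (2.9) p.266 (bookkeeping)] -/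
theorem eventually_betaOfRecord₁₃_zero_eq_betaMerged (θ : Stage13HParams F N) (hγθ : 0 < θ.γ) :
    ∀ᶠ x in 𝓝[>] (0 : ℝ),
      betaOfRecord₁₃ F N θ.toStage13Params 0 (fun _ => x) =
        (letI := θ.instVβ₁; letI := θ.instVβ₂; letI := θ.instιβ
         betaMerged F (mergedTermFamilyMatT F N (TcanOfRecord F N) (chiβOfRecord₁₃ F N θ.toStage13Params) θ.εbg) θ.ρ8 θ.bV 0 (fun _ => x)) := by
  have hlt : ∀ᶠ x in 𝓝[>] (0 : ℝ), x < θ.γ := (eventually_lt_nhds hγθ).filter_mono nhdsWithin_le_nhds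
  have hpos : ∀ᶠ x in 𝓝[>] (0 : ℝ), 0 < x := eventually_mem_nhdsWithin
  filter_upwards [hlt, hpos] with x hx hx0
  exact betaOfRecord₁₃_zero_const_of_le θ hx0 hx.le

/-- ★★ **THE EXACT CRITERION AT THE RECORD** (`0 < θ.γ`; every `h`): THE `K ≥ 1` WINDOW OF K1⁷ ∕ K2⁷ AT `datumOfRecord₁₃SepCoPH F N θ h` HOLDS IFF
`∀ M, ∃ᶠ g in 𝓝[>] 0, M ≤ 1∕g² − β_m 0 (g)`, `β_m` the MERGED β of the record's `(TcanOfRecord, χ^{(2.9)})` term family — «`g⁻² − β_m 0 (g)` exceeds every level along every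
approach to `0⁺`».  Exactly between g0's sufficient «`liminf g²β_m 0 < 1`» and necessary «`g²β_m 0 < 1` frequently»; the one-loop number, the residual objects, the provisos
and every other numeral of `θ` are NOT read. [cite: Balaban1987RG1, (0.17)–(0.20) pp.255–256, (1.20)–(1.22) p.264, (2.9) p.266, (2.12)–(2.14) p.268; Balaban1989LargeFieldII, Thm 1 + (0.1) pp.355–356 (bookkeeping + elementary)] -/
theorem window_datumOfRecord₁₃SepCoPH_iff_frequently_le_merged (θ : Stage13HParams F N) (h : θ.Provisos₁₃SepCoPH F N) (hγθ : 0 < θ.γ) :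
    (∃ γ₁ : ℝ, 0 < γ₁ ∧ ∀ γ : ℝ, 0 < γ → γ ≤ γ₁ →
        ∃ P : B12.RunParams, 1 ≤ P.K ∧ ((datumOfRecord₁₃SepCoPH F N θ h).C P).flow.InInterval γ P.K) ↔
      ∀ M : ℝ, ∃ᶠ x in 𝓝[>] (0 : ℝ),
        M ≤ 1 / x ^ 2 -
          (letI := θ.instVβ₁; letI := θ.instVβ₂; letI := θ.instιβ
           betaMerged F (mergedTermFamilyMatT F N (TcanOfRecord F N) (chiβOfRecord₁₃ F N θ.toStage13Params) θ.εbg) θ.ρ8 θ.bV 0 (fun _ => x)) := by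
  rw [window_datumOfRecord₁₃SepCoPH_iff_frequently_le_firstBeta θ h]
  refine forall_congr' fun M => Filter.frequently_congr ?_
  filter_upwards [eventually_betaOfRecord₁₃_zero_eq_betaMerged θ hγθ] with x hx
  rw [hx]

/-- ★★ **THE EXACT CRITERION AT THE RECORD, `IsBoundedUnder` form** (`0 < θ.γ`): the window at the Stage-13 datum ↔
`¬ Filter.IsBoundedUnder (· ≤ ·) (𝓝[>] 0) (g ↦ 1∕g² − β_m 0 (g))` — NOT «bounded», NOT «has a limit»: merely «`g⁻² − β_m 0` is not eventually bounded above at `0⁺`» is what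
NODE O's first-step analysis must deliver for this conjunct. [cite: Balaban1987RG1, (0.17)–(0.20) pp.255–256, (1.20)–(1.22) p.264, (2.12)–(2.14) p.268; Balaban1989LargeFieldII, Thm 1 + (0.1) pp.355–356 (bookkeeping + elementary)] -/
theorem window_datumOfRecord₁₃SepCoPH_iff_not_isBoundedUnder_merged (θ : Stage13HParams F N) (h : θ.Provisos₁₃SepCoPH F N) (hγθ : 0 < θ.γ) :
    (∃ γ₁ : ℝ, 0 < γ₁ ∧ ∀ γ : ℝ, 0 < γ → γ ≤ γ₁ →
        ∃ P : B12.RunParams, 1 ≤ P.K ∧ ((datumOfRecord₁₃SepCoPH F N θ h).C P).flow.InInterval γ P.K) ↔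
      ¬ IsBoundedUnder (· ≤ ·) (𝓝[>] (0 : ℝ)) (fun x : ℝ =>
        1 / x ^ 2 -
          (letI := θ.instVβ₁; letI := θ.instVβ₂; letI := θ.instιβ
           betaMerged F (mergedTermFamilyMatT F N (TcanOfRecord F N) (chiβOfRecord₁₃ F N θ.toStage13Params) θ.εbg) θ.ρ8 θ.bV 0 (fun _ => x))) :=
  (window_datumOfRecord₁₃SepCoPH_iff_frequently_le_merged θ h hγθ).trans (forall_frequently_le_iff_not_isBoundedUnder _ _)

/-- ★★ **THE DISPROVER's EXACT TARGET AT THE RECORD** (`0 < θ.γ`): K1⁷'s window conjunct at `datumOfRecord₁₃SepCoPH F N θ h` FAILS IFF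
`∃ M, ∀ᶠ g in 𝓝[>] 0, 1∕g² − M ≤ β_m 0 (g)` — the merged first β-function of record DOMINATES `g⁻² − M` near `0⁺` (print's `β_m 0 (g) → β⁰_1`, (2.12)–(2.14) p. 268, is the opposite
regime; no lemma of the tree decides it).  This is the ONLY way the conjunct can fail at an admissible `θ`. [cite: Balaban1987RG1, (0.17)–(0.20) pp.255–256, (1.20)–(1.22) p.264, (2.12)–(2.14) p.268; Balaban1989LargeFieldII, Thm 1 + (0.1) pp.355–356 (bookkeeping + elementary)] -/
theorem not_window_datumOfRecord₁₃SepCoPH_iff_eventually_le_merged (θ : Stage13HParams F N) (h : θ.Provisos₁₃SepCoPH F N) (hγθ : 0 < θ.γ) :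
    (¬ ∃ γ₁ : ℝ, 0 < γ₁ ∧ ∀ γ : ℝ, 0 < γ → γ ≤ γ₁ →
        ∃ P : B12.RunParams, 1 ≤ P.K ∧ ((datumOfRecord₁₃SepCoPH F N θ h).C P).flow.InInterval γ P.K) ↔
      ∃ M : ℝ, ∀ᶠ x in 𝓝[>] (0 : ℝ),
        1 / x ^ 2 - M ≤
          (letI := θ.instVβ₁; letI := θ.instVβ₂; letI := θ.instιβ
           betaMerged F (mergedTermFamilyMatT F N (TcanOfRecord F N) (chiβOfRecord₁₃ F N θ.toStage13Params) θ.εbg) θ.ρ8 θ.bV 0 (fun _ => x)) := by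
  rw [window_datumOfRecord₁₃SepCoPH_iff_not_isBoundedUnder_merged θ h hγθ, not_not]
  exact isBoundedUnder_sub_iff_exists_eventually_le _ _ _

/-- ★ **THE WEAKEST LOCATED SUFFICIENT INPUT AT THE RECORD** (`0 < θ.γ`): a FREQUENT upper bound `∃ b, ∃ᶠ g in 𝓝[>] 0, β_m 0 (g) ≤ b` on the merged first β-function of record
— along SOME sequence of bare couplings `gₙ → 0⁺` it stays below SOME constant — gives the window at the Stage-13 datum.  DISPLAYED, not discharged (NODE O, [I] p. 264 at `k = 0`).
[cite: Balaban1987RG1, (0.17)–(0.20) pp.255–256, (1.20)–(1.22) p.264 and §1 p.264; Balaban1989LargeFieldII, Thm 1 + (0.1) pp.355–356 (bookkeeping)] -/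
theorem window_datumOfRecord₁₃SepCoPH_of_frequently_betaMerged_le (θ : Stage13HParams F N) (h : θ.Provisos₁₃SepCoPH F N) (hγθ : 0 < θ.γ)
    (hfr : letI := θ.instVβ₁; letI := θ.instVβ₂; letI := θ.instιβ
      ∃ b : ℝ, ∃ᶠ x in 𝓝[>] (0 : ℝ),
        betaMerged F (mergedTermFamilyMatT F N (TcanOfRecord F N) (chiβOfRecord₁₃ F N θ.toStage13Params) θ.εbg) θ.ρ8 θ.bV 0 (fun _ => x) ≤ b) :
    ∃ γ₁ : ℝ, 0 < γ₁ ∧ ∀ γ : ℝ, 0 < γ → γ ≤ γ₁ →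
      ∃ P : B12.RunParams, 1 ≤ P.K ∧ ((datumOfRecord₁₃SepCoPH F N θ h).C P).flow.InInterval γ P.K := by
  letI := θ.instVβ₁; letI := θ.instVβ₂; letI := θ.instιβ
  obtain ⟨b, hb⟩ := hfr
  refine (window_datumOfRecord₁₃SepCoPH_iff_frequently_le_merged θ h hγθ).mpr fun M => ?_
  exact (hb.and_eventually (eventually_le_one_div_sq_nhdsGT (M + b))).mono fun x ⟨hx, hM⟩ => by linarith

end Record

/-! ## §4. The item's `N = 2` text (the last conjunct of K1⁷ `StabilityBAtRecordR13SepCoPH` ∕ the window hypothesis of K2⁷ `EndpointGivenBR13SepCoPH`, verbatim) -/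

section ItemText

variable {F : T4Family}

/-- ★ `N = 2`, KEYED ON ADMISSIBILITY (the item's own conjunct `θ.Admissible F 2`; `0 < θ.γ` is its Stage-9 clause `Stage9Params.Admissible.gamma_pos`): K1⁷'s last conjunct at
`(θ, h)` ↔ `¬ IsBoundedUnder (· ≤ ·) (𝓝[>] 0) (g ↦ 1∕g² − β_m 0 (g))`. [cite: Balaban1987RG1, (0.17)–(0.20) pp.255–256, (1.20)–(1.22) p.264, (2.12)–(2.14) p.268; Balaban1989LargeFieldII, Thm 1 + (0.1) pp.355–356 (bookkeeping + elementary)] -/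
theorem window₂_datumOfRecord₁₃SepCoPH_iff_not_isBoundedUnder_merged (θ : Stage13HParams F 2) (h : θ.Provisos₁₃SepCoPH F 2) (hθ : θ.Admissible F 2) :
    (∃ γ₁ : ℝ, 0 < γ₁ ∧ ∀ γ : ℝ, 0 < γ → γ ≤ γ₁ →
        ∃ P : Literature.MathematicalPhysics.QuantumFieldTheory.Balaban1983to89.B12.RunParams, 1 ≤ P.K ∧
          ((Literature.MathematicalPhysics.QuantumFieldTheory.Balaban1983to89.Node00.datumOfRecord₁₃SepCoPH F 2 θ h).C P).flow.InInterval γ P.K) ↔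
      ¬ IsBoundedUnder (· ≤ ·) (𝓝[>] (0 : ℝ)) (fun x : ℝ =>
        1 / x ^ 2 -
          (letI := θ.instVβ₁; letI := θ.instVβ₂; letI := θ.instιβ
           betaMerged F (mergedTermFamilyMatT F 2 (TcanOfRecord F 2) (chiβOfRecord₁₃ F 2 θ.toStage13Params) θ.εbg) θ.ρ8 θ.bV 0 (fun _ => x))) :=
  window_datumOfRecord₁₃SepCoPH_iff_not_isBoundedUnder_merged θ h hθ.toStage9.gamma_pos

/-- ★ `N = 2`, KEYED ON ADMISSIBILITY: K1⁷'s last conjunct at an admissible `(θ, h)` FAILS ↔ `∃ M, ∀ᶠ g in 𝓝[>] 0, 1∕g² − M ≤ β_m 0 (g)` — the disprover's exact target.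
[cite: Balaban1987RG1, (0.17)–(0.20) pp.255–256, (1.20)–(1.22) p.264, (2.12)–(2.14) p.268; Balaban1989LargeFieldII, Thm 1 + (0.1) pp.355–356 (bookkeeping + elementary)] -/
theorem not_window₂_datumOfRecord₁₃SepCoPH_iff_eventually_le_merged (θ : Stage13HParams F 2) (h : θ.Provisos₁₃SepCoPH F 2) (hθ : θ.Admissible F 2) :
    (¬ ∃ γ₁ : ℝ, 0 < γ₁ ∧ ∀ γ : ℝ, 0 < γ → γ ≤ γ₁ →
        ∃ P : Literature.MathematicalPhysics.QuantumFieldTheory.Balaban1983to89.B12.RunParams, 1 ≤ P.K ∧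
          ((Literature.MathematicalPhysics.QuantumFieldTheory.Balaban1983to89.Node00.datumOfRecord₁₃SepCoPH F 2 θ h).C P).flow.InInterval γ P.K) ↔
      ∃ M : ℝ, ∀ᶠ x in 𝓝[>] (0 : ℝ),
        1 / x ^ 2 - M ≤
          (letI := θ.instVβ₁; letI := θ.instVβ₂; letI := θ.instιβ
           betaMerged F (mergedTermFamilyMatT F 2 (TcanOfRecord F 2) (chiβOfRecord₁₃ F 2 θ.toStage13Params) θ.εbg) θ.ρ8 θ.bV 0 (fun _ => x)) :=
  not_window_datumOfRecord₁₃SepCoPH_iff_eventually_le_merged θ h hθ.toStage9.gamma_pos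

end ItemText

end Summit.QuantumFields.YangMills.Theorems.BalabanUVNodesK1WindowExactCriterion

end
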